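import Summits.HodgeConjecture.CorCM.CycleClassFacts
import Summits.HodgeConjecture.CorCM.Model.DiagonalDegree
import Summits.HodgeConjecture.CorCM.RationalExteriorSpan
import Summits.HodgeConjecture.CorCM.KunnethDegreeOne
import Literature.AlgebraicGeometry.ComplexMultiplication.RosatiPolarizationCM
import Literature.AlgebraicGeometry.Milne1999.CMHodgeHypothesisFromCMTypedProducts
import Literature.AlgebraicGeometry.HodgeTheory.HardLefschetzNFoldHolds
import Literature.AlgebraicGeometry.HodgeTheory.LefschetzDecompositionSingular
import Literature.AlgebraicTopology.SingularHomology.CohomologyOfPoint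
import HarnessLib

/-!
# COR-CM model layer (M22 input R2, part A): a rational algebraic Rosati class `θ` on every
# coded CM realisation, in Betti form

Cell `pub-hodgecm2` (COR-CM = stage 2 of the Hodge ladder), seat `b13`; row M22 `Fact_algDuality` of
`BINDER-OWNERS.md`, input **R2** ("a polarisation of the chosen CM realisation whose Rosati involution
is complex conjugation on `K`"), PART A = one coded realisation (part B, the corner product with the
diagonal action, is seat b26's `CorCM/Model/RosatiThetaProduct.lean`).

The Literature THEOREM `ComplexMultiplication.IsCMTypeRealisation.exists_rosati_kaehlerClass`
(file `Literature/AlgebraicGeometry/ComplexMultiplication/RosatiPolarizationCM.lean`, Shimura 1998 §6.2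
Thm. 4 (3) / Milne CM Ex. 2.9, proved there by van Geemen's averaging) produces, on the COMPLEX carriers
`H•(A(ℂ); ℂ)`, a class `h` which is rational (`IsRationalClass`), algebraic (`algebraicClasses A.X 1`), a
non-zero real multiple of a Kähler class, and Rosati-compatible for the polarization pairing
`Motives.polarizationPairingOne A.X h (dim A - 1)` (`Q_h(ι(a)^*x, y) = Q_h(x, ι(ā)^*y)`, `a ∈ 𝓞_K`).  The COR-CM
model universe `Model.universeOf` (and row M22's kernel K-a, seat model-1, D-signature of 2026-08-20)
reads RATIONAL Betti carriers: `Motives.bettiCohomology`, `PicardCM.ratAlgebraicClasses`,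
`BettiUniverse.pull/cup/tr`, `BettiUniverse.cmEndAction`.  This file is the transcription:

* §1 (general `X : SchemeOver ℂ`): `exists_eq_ofRatClass_mem_ratAlgebraicClasses` (rational + algebraic on
  `H(ℂ)` ⇒ a class of `ratAlgebraicClasses`); `ofRatClass_lefschetzPowTo` (the rational lattice commutes with
  the Lefschetz iterates); `hasHardLefschetzProperty_of_isKaehlerClass`;
  `lefschetzPowTo_top_bettiOne_ne_zero` (**`θⁿ ≠ 0` in `H²ⁿ(X(ℂ); ℚ)`** for a rational `θ` with a Kähler
  complex multiple — hard Lefschetz, Voisin I Thm. 6.25, the tree's hodge.S14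
  `Motives.hasHardLefschetzProperty_kaehlerClass_holds`); `lefschetzPow_cup_eq_of_polarizationPairingOne`
  (a `polarizationPairingOne` identity on `H¹(ℂ)` for two operators with rational models descends to the
  identity of CLASSES `θʲ ⌣ (u x ⌣ y) = θʲ ⌣ (x ⌣ u' y)` in `H^{2+2j}(X(ℂ); ℚ)`), with the pull-back instance
  `lefschetzPow_cup_pull_eq_of_polarizationPairingOne`.
* §2 (one realisation): `exists_rosatiTheta_of_isCMTypeRealisation` — for `IsCMTypeRealisation Φ A ι θ_A`
  there is `θ ∈ ratAlgebraicClasses A.X 1` with `θ^{dim A} ≠ 0` and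
  `θ^{g-1} ⌣ (ι(a)^*x ⌣ y) = θ^{g-1} ⌣ (x ⌣ ι(ā)^*y)` for all `a ∈ 𝓞_K`, `x y ∈ H¹(A(ℂ); ℚ)`, and ALSO the
  complex identity for the FIELD action `θ_A : K → End_ℂ H¹(A(ℂ); ℂ)` and every `a : K`;
  `exists_rosatiTheta_cmRealisation` / `var_exists_rosatiTheta` — the same for the chosen realisation
  `PicardCM.cmRealisation h₃ c` of a CM code, in the model's spelling `PicardCM.Var.Coh/alg/dim (.cm c)`.
* §3 (the model's `cmAct`): `var_exists_rosatiTheta_cmAction` — the identity for the RATIONAL `K`-action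
  `BettiUniverse.cmAction` (the `ι` of `(universeOf …).cmAct K Φ`, `BettiUniverse.cmEndAction_ι`) and EVERY
  `a : K` (`K ≃+* c.E` abstract, as in `Model.var_deg_diag`), by fractions `a = p/q` over `𝓞_K`
  (`rosati_of_ringOfIntegers`) and `BettiUniverse.ofRatClass_cmAction`.

Spelling of powers: `lefschetzPowTo θ t a m h : Hᵃ → Hᵐ` / `lefschetzPow θ t a : Hᵃ → H^{a+2t}` are the
tree's ITERATED LEFT CUP PRODUCTS `x ↦ θ ⌣ (θ ⌣ ⋯ ⌣ x)` with `⌣ = SingularHomology.cupProduct = Motives.bettiCup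
= BettiUniverse.cup` (all `rfl`), so `lefschetzPowTo θ g 0 (2g) _ 1 = θ^g` and
`lefschetzPow θ (g-1) 2 (x ⌣ y) = θ^{g-1} ⌣ (x ⌣ y) = Q_θ(x, y)` before the trace.  No definition is introduced;
nothing is cited as a fact: every declaration is a theorem of the tree's theorems.
-/

noncomputable section

open CategoryTheory
open NumberField
open Literature.AlgebraicTopology.SingularHomology
open Literature.Geometry.Kaehler
open Literature.AlgebraicGeometry.Motives (SchemeOver ComplexPoints IsSmoothProjective bettiCohomology bettiOne
  AbelianVariety CMType polarizationPairingOne)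
open Literature.AlgebraicGeometry.HodgeTheory
open Literature.AlgebraicGeometry.ComplexMultiplication
open Literature.NumberTheory.Automorphic.PicardCM

namespace Summit.HodgeConjecture.CorCM.Model

/-! ### §1 Descent lemmas: complex statements to rational Betti carriers -/

section General

variable {n : ℕ} {X : SchemeOver ℂ}

/-- **Rational + algebraic on `H²ᵖ(X(ℂ); ℂ)` ⇒ a rational algebraic class**: a class `h` which is rational
(`IsRationalClass`, i.e. in the image of `Hᵏ(ℚ) → Hᵏ(ℂ)`, `isRationalClass_iff_mem_range_ofRatClass`) and
algebraic is `θ ⊗ 1` for a `θ ∈ ratAlgebraicClasses X p` (`mem_ratAlgebraicClasses_iff`, by definition). -/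
theorem exists_eq_ofRatClass_mem_ratAlgebraicClasses {p : ℕ} {h : complexBetti X (2 * p)}
    (hQ : IsRationalClass h) (halg : h ∈ algebraicClasses X p) :
    ∃ θ : bettiCohomology X (2 * p),
      ofRatClass (ComplexPoints X) (2 * p) θ = h ∧ θ ∈ ratAlgebraicClasses X p := by
  obtain ⟨θ, rfl⟩ := (isRationalClass_iff_mem_range_ofRatClass h).1 hQ
  exact ⟨θ, rfl, (mem_ratAlgebraicClasses_iff X p θ).2 halg⟩

/-- The rational lattice `Hᵏ(X(ℂ); ℚ) → Hᵏ(X(ℂ); ℂ)` commutes with the Lefschetz iterates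
`Lᵗ_θ : Hᵃ → Hᵐ` (change of coefficients is multiplicative, `ringChange_lefschetzPowTo`). -/
theorem ofRatClass_lefschetzPowTo (θ : bettiCohomology X 2) (t a m : ℕ) (h : a + 2 * t = m)
    (x : bettiCohomology X a) :
    ofRatClass (ComplexPoints X) m (lefschetzPowTo θ t a m h x) =
      lefschetzPowTo (ofRatClass (ComplexPoints X) 2 θ) t a m h (ofRatClass (ComplexPoints X) a x) := by
  rw [ofRatClass_eq_ringChange, ofRatClass_eq_ringChange, ofRatClass_eq_ringChange]
  exact ringChange_lefschetzPowTo θ (algebraMap ℚ ℂ) t a m h x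

/-- The rational lattice commutes with `Lᵗ_θ : Hᵃ → H^{a+2t}` (`lefschetzPow` spelling). -/
theorem ofRatClass_lefschetzPow (θ : bettiCohomology X 2) (t a : ℕ) (x : bettiCohomology X a) :
    ofRatClass (ComplexPoints X) (a + 2 * t) (lefschetzPow θ t a x) =
      lefschetzPow (ofRatClass (ComplexPoints X) 2 θ) t a (ofRatClass (ComplexPoints X) a x) :=
  ofRatClass_lefschetzPowTo θ t a (a + 2 * t) rfl x

/-- **A Kähler class has the hard Lefschetz property** (Voisin I Thm. 6.25 = the tree's hodge.S14
`Motives.hasHardLefschetzProperty_kaehlerClass_holds`, read through the Hodge model and the natural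
multiplicative de Rham family packaged in `IsKaehlerClass`). -/
theorem hasHardLefschetzProperty_of_isKaehlerClass (hX : IsSmoothProjective n X) {H : complexBetti X 2}
    (hH : IsKaehlerClass n X H) : HasHardLefschetzProperty H n := by
  obtain ⟨A, e, he, hem, hK⟩ := (isKaehlerClass_iff H).1 hH
  exact hK.hasHardLefschetzProperty hX
    Literature.AlgebraicGeometry.Motives.hasHardLefschetzProperty_kaehlerClass_holds he hem

/-- The unit class `1 ∈ H⁰(Y; R)` of a path-connected space is non-zero (its value at a point is `1`,
`singularCohomologyZeroEquiv`). -/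
theorem singularCohomology_one_ne_zero {Y : Type} [TopologicalSpace Y] [PathConnectedSpace Y]
    (R : Type) [CommRing R] [Nontrivial R] : singularCohomology.one R Y ≠ 0 := by
  intro h
  have h1 : singularCohomologyZeroEquiv R R Y (singularCohomology.one R Y) = 1 := by
    rw [singularCohomology.one, singularCohomologyZeroEquiv_π,
      singularCochainComplex.cocyclesZeroEquiv_apply, singularCochainComplex.iCocycles_mk,
      cochainOne_apply]
  rw [h, map_zero] at h1
  exact zero_ne_one h1

/-- **`θⁿ ≠ 0` in `H²ⁿ(X(ℂ); ℚ)` for a rational class `θ` with a Kähler complex multiple** (`X` smooth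
projective of dimension `n`, `s • (θ ⊗ 1)` Kähler for some `s ≠ 0`): hard Lefschetz makes
`Lⁿ_{θ ⊗ 1} : H⁰ → H²ⁿ` injective (it is invariant under the non-zero scalar `s`), `1 ≠ 0` in `H⁰` of the
path-connected `X(ℂ)`, and `⊗ 1` is injective and commutes with `Lⁿ`.  Here `lefschetzPowTo θ n 0 (2n) _ 1`
is the `n`-fold iterated cup product `θ ⌣ (θ ⌣ ⋯ ⌣ 1)` (`BettiUniverse.cup`). -/
theorem lefschetzPowTo_top_bettiOne_ne_zero (hX : IsSmoothProjective n X) {θ : bettiCohomology X 2}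
    {s : ℂ} (hs : s ≠ 0) (hK : IsKaehlerClass n X (s • ofRatClass (ComplexPoints X) 2 θ))
    (h2 : 0 + 2 * n = 2 * n) :
    lefschetzPowTo θ n 0 (2 * n) h2 (bettiOne X) ≠ 0 := by
  -- hard Lefschetz for `θ ⊗ 1 = s⁻¹ • (s • (θ ⊗ 1))`
  have hHL : HasHardLefschetzProperty (ofRatClass (ComplexPoints X) 2 θ) n := by
    have h := HasHardLefschetzProperty.smul (hasHardLefschetzProperty_of_isKaehlerClass hX hK) (inv_ne_zero hs)
    rwa [smul_smul, inv_mul_cancel₀ hs, one_smul] at h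
  have hinj := (bijective_lefschetzPowTo_of_hasHardLefschetz _ hHL (j := n) (k := 0) (by omega)
    (2 * n) h2).1
  haveI := pathConnectedSpace_complexPoints hX
  intro h0
  have h1 : lefschetzPowTo (ofRatClass (ComplexPoints X) 2 θ) n 0 (2 * n) h2
      (singularCohomology.one ℂ (ComplexPoints X)) = 0 := by
    rw [← ofRatClass_one, ← ofRatClass_lefschetzPowTo]
    change ofRatClass (ComplexPoints X) (2 * n) (lefschetzPowTo θ n 0 (2 * n) h2 (bettiOne X)) = 0
    rw [h0, map_zero]
  refine singularCohomology_one_ne_zero (Y := ComplexPoints X) ℂ (hinj ?_)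
  rw [h1, map_zero]

/-- **Descent of a polarization-pairing identity.**  Let `u u'` be `ℚ`-linear operators on `H¹(X(ℂ); ℚ)`
with complexifications `U U'` (`(u x) ⊗ 1 = U (x ⊗ 1)`), and suppose
`Q_{θ ⊗ 1, j}(U x, y) = Q_{θ ⊗ 1, j}(x, U' y)` on `H¹(X(ℂ); ℂ)` (`Motives.polarizationPairingOne`,
`= (θ ⊗ 1)ʲ ⌣ (· ⌣ ·)`).  Then already the rational CLASSES agree: `θʲ ⌣ (u x ⌣ y) = θʲ ⌣ (x ⌣ u' y)` in
`H^{2+2j}(X(ℂ); ℚ)` (`⊗ 1` is injective and multiplicative). -/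
theorem lefschetzPow_cup_eq_of_polarizationPairingOne {θ : bettiCohomology X 2} {j : ℕ}
    {u u' : bettiCohomology X 1 →ₗ[ℚ] bettiCohomology X 1} {U U' : complexBetti X 1 → complexBetti X 1}
    (hu : ∀ x, ofRatClass (ComplexPoints X) 1 (u x) = U (ofRatClass (ComplexPoints X) 1 x))
    (hu' : ∀ x, ofRatClass (ComplexPoints X) 1 (u' x) = U' (ofRatClass (ComplexPoints X) 1 x))
    (h : ∀ x y : complexBetti X 1,
      polarizationPairingOne X (ofRatClass (ComplexPoints X) 2 θ) j (U x) y =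
        polarizationPairingOne X (ofRatClass (ComplexPoints X) 2 θ) j x (U' y))
    (x y : bettiCohomology X 1) :
    lefschetzPow θ j 2 (BettiUniverse.cup X 1 1 (u x) y) =
      lefschetzPow θ j 2 (BettiUniverse.cup X 1 1 x (u' y)) := by
  apply ofRatClass_injective
  rw [ofRatClass_lefschetzPow, ofRatClass_lefschetzPow]
  have hc1 := ofRatClass_cup 1 1 (u x) y
  have hc2 := ofRatClass_cup 1 1 x (u' y)
  rw [hu] at hc1
  rw [hu'] at hc2
  change lefschetzPow _ j 2 (ofRatClass (ComplexPoints X) (1 + 1) (BettiUniverse.cup X 1 1 (u x) y)) =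
    lefschetzPow _ j 2 (ofRatClass (ComplexPoints X) (1 + 1) (BettiUniverse.cup X 1 1 x (u' y)))
  rw [hc1, hc2]
  exact h _ _

/-- **Descent, pull-back instance**: if `Q_{θ ⊗ 1, j}(f^* x, y) = Q_{θ ⊗ 1, j}(x, g^* y)` on `H¹(X(ℂ); ℂ)` for two
endomorphisms `f g` of `X`, then `θʲ ⌣ (f^*x ⌣ y) = θʲ ⌣ (x ⌣ g^*y)` in `H^{2+2j}(X(ℂ); ℚ)` for all
`x y ∈ H¹(X(ℂ); ℚ)` (`⊗ 1` is natural, `Model.ofRatClass_pull`). -/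
theorem lefschetzPow_cup_pull_eq_of_polarizationPairingOne {θ : bettiCohomology X 2} {j : ℕ}
    {f g : X ⟶ X}
    (h : ∀ x y : complexBetti X 1,
      polarizationPairingOne X (ofRatClass (ComplexPoints X) 2 θ) j (complexBetti.map f 1 x) y =
        polarizationPairingOne X (ofRatClass (ComplexPoints X) 2 θ) j x (complexBetti.map g 1 y))
    (x y : bettiCohomology X 1) :
    lefschetzPow θ j 2 (BettiUniverse.cup X 1 1 (BettiUniverse.pull f 1 x) y) =
      lefschetzPow θ j 2 (BettiUniverse.cup X 1 1 x (BettiUniverse.pull g 1 y)) :=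
  lefschetzPow_cup_eq_of_polarizationPairingOne (u := BettiUniverse.pull f 1) (u' := BettiUniverse.pull g 1)
    (fun x ↦ ofRatClass_pull f 1 x) (fun x ↦ ofRatClass_pull g 1 x) h x y

end General

/-! ### §2 Extension from `𝓞_K` to `K`, and one CM realisation -/

section Realisation

/-- A ring isomorphism of CM fields intertwines the complex conjugations (both are read off any complex
embedding, Mathlib `IsCMField.complexEmbedding_complexConj`). -/
theorem ringEquiv_complexConj {K : Type} [Field K] [NumberField K] [IsCMField K]
    {E : Type} [Field E] [NumberField E] [IsCMField E] (e : K ≃+* E) (k : K) :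
    e (IsCMField.complexConj K k) = IsCMField.complexConj E (e k) := by
  obtain ⟨φ⟩ := (inferInstance : Nonempty (E →+* ℂ))
  apply φ.injective
  rw [IsCMField.complexEmbedding_complexConj E φ (e k)]
  exact IsCMField.complexEmbedding_complexConj K (φ.comp e.toRingHom) k

/-- The complex conjugate of an algebraic integer is an algebraic integer (`map_isIntegral_int`). -/
theorem isIntegral_complexConj {K : Type} [Field K] [NumberField K] [IsCMField K] (a : 𝓞 K) :
    IsIntegral ℤ (IsCMField.complexConj K (a : K)) :=
  map_isIntegral_int ((IsCMField.complexConj K).toRingEquiv.toRingHom) a.isIntegral_coe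

/-- **Extension of a Rosati identity from `𝓞_K` to `K`.**  Let `Θ : K →+* End_ℂ(V)` be a ring homomorphism
and `Q` a `ℂ`-bilinear pairing on `V` with `Q(Θ(a) x, y) = Q(x, Θ(ā) y)` for all `a ∈ 𝓞_K`.  Then the identity
holds for every `a ∈ K`: write `a = p / q` with `p, q ∈ 𝓞_K`, `q ≠ 0` (`IsFractionRing (𝓞 K) K`); `Θ(q)` is
invertible, and the identities for `p` and for `q` combine. -/
theorem rosati_of_ringOfIntegers {K : Type} [Field K] [NumberField K] [IsCMField K]
    {V W : Type*} [AddCommGroup V] [Module ℂ V] [AddCommGroup W] [Module ℂ W]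
    (Θ : K →+* Module.End ℂ V) (Q : V →ₗ[ℂ] V →ₗ[ℂ] W)
    (h : ∀ (a ac : 𝓞 K), (ac : K) = IsCMField.complexConj K (a : K) →
      ∀ x y : V, Q (Θ (a : K) x) y = Q x (Θ (ac : K) y))
    (a : K) (x y : V) : Q (Θ a x) y = Q x (Θ (IsCMField.complexConj K a) y) := by
  obtain ⟨p, q, hq, hpq⟩ := IsFractionRing.div_surjective (A := 𝓞 K) a
  have hq0 : (q : K) ≠ 0 := RingOfIntegers.coe_ne_zero_iff.2 (nonZeroDivisors.ne_zero hq)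
  -- conjugates of `p`, `q` as algebraic integers
  set pc : 𝓞 K := ⟨IsCMField.complexConj K (p : K), isIntegral_complexConj p⟩ with hpc
  set qc : 𝓞 K := ⟨IsCMField.complexConj K (q : K), isIntegral_complexConj q⟩ with hqc
  have hp := h p pc rfl
  have hq' := h q qc rfl
  -- `x = Θ q x'` with `x' = Θ q⁻¹ x`
  set x' : V := Θ ((q : K)⁻¹) x with hx'
  have hxx : Θ (q : K) x' = x := by
    rw [hx', ← Module.End.mul_apply, ← map_mul, mul_inv_cancel₀ hq0, map_one, Module.End.one_apply]
  have ha : a = (p : K) * ((q : K)⁻¹) := by rw [← hpq, div_eq_mul_inv]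
  calc Q (Θ a x) y = Q (Θ a (Θ (q : K) x')) y := by rw [hxx]
    _ = Q (Θ (p : K) x') y := by
        rw [← Module.End.mul_apply, ← map_mul, ha, inv_mul_cancel_right₀ hq0]
    _ = Q x' (Θ (pc : K) y) := hp x' y
    _ = Q x' (Θ (qc : K) (Θ (IsCMField.complexConj K a) y)) := by
        have hpq' : (pc : K) = (qc : K) * IsCMField.complexConj K a := by
          change IsCMField.complexConj K (p : K) = IsCMField.complexConj K (q : K) * IsCMField.complexConj K a
          rw [← map_mul, ha, ← mul_assoc, mul_comm (q : K) (p : K), mul_assoc, mul_inv_cancel₀ hq0, mul_one]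
        rw [← Module.End.mul_apply, ← map_mul, ← hpq']
    _ = Q (Θ (q : K) x') (Θ (IsCMField.complexConj K a) y) := (hq' x' _).symm
    _ = Q x (Θ (IsCMField.complexConj K a) y) := by rw [hxx]

/-- **R2 in Betti form for a realisation of a CM type.**  For `(A, ι, θ_A)` realising `(K; Φ)`
(`IsCMTypeRealisation`: `ι : 𝓞_K → End A`, `θ_A(a) = ι(a)^*` on `H¹`, one-dimensional eigenlines) there is a
RATIONAL class `θ ∈ H²(A(ℂ); ℚ)` which is rational-algebraic (`ratAlgebraicClasses A.X 1`), has `θ^{dim A} ≠ 0`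
in `H^{2 dim A}(A(ℂ); ℚ)`, whose pairing `θ^{g-1} ⌣ (· ⌣ ·)` on `H¹(A(ℂ); ℚ)` satisfies the Rosati identity
`θ^{g-1} ⌣ (ι(a)^*x ⌣ y) = θ^{g-1} ⌣ (x ⌣ ι(ā)^*y)` for every `a ∈ 𝓞_K` (`ā` its complex conjugate), and whose
complexified pairing satisfies it for the FIELD action `θ_A` and every `a : K`.
Transcription of `IsCMTypeRealisation.exists_rosati_kaehlerClass` (Shimura 1998 §6.2 Thm. 4 (3)). -/
theorem exists_rosatiTheta_of_isCMTypeRealisation {K : Type} [Field K] [NumberField K] [IsCMField K]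
    {Φ : CMType K} {A : AbelianVariety ℂ} {ιA : 𝓞 K →+* End A}
    {θA : K →+* Module.End ℂ (complexBetti A.X 1)} (hA : IsCMTypeRealisation Φ A ιA θA) :
    ∃ θ : bettiCohomology A.X 2, θ ∈ ratAlgebraicClasses A.X 1 ∧
      lefschetzPowTo θ A.dim 0 (2 * A.dim) (zero_add _) (bettiOne A.X) ≠ 0 ∧
      (∀ (a ac : 𝓞 K), (ac : K) = IsCMField.complexConj K (a : K) → ∀ x y : bettiCohomology A.X 1,
        lefschetzPow θ (A.dim - 1) 2
            (BettiUniverse.cup A.X 1 1 (BettiUniverse.pull (ιA a).hom.hom.hom 1 x) y) =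
          lefschetzPow θ (A.dim - 1) 2
            (BettiUniverse.cup A.X 1 1 x (BettiUniverse.pull (ιA ac).hom.hom.hom 1 y))) ∧
      ∀ (a : K) (x y : complexBetti A.X 1),
        polarizationPairingOne A.X (ofRatClass (ComplexPoints A.X) 2 θ) (A.dim - 1) (θA a x) y =
          polarizationPairingOne A.X (ofRatClass (ComplexPoints A.X) 2 θ) (A.dim - 1) x
            (θA (IsCMField.complexConj K a) y) := by
  obtain ⟨h, hQ, halg, ⟨s, hs, hK⟩, hros⟩ := hA.exists_rosati_kaehlerClass
  obtain ⟨θ, rfl, hθ⟩ := exists_eq_ofRatClass_mem_ratAlgebraicClasses (p := 1) hQ halg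
  refine ⟨θ, hθ, ?_, fun a ac hac x y ↦ ?_, ?_⟩
  · exact lefschetzPowTo_top_bettiOne_ne_zero (AbelianVariety.isSmoothProjective_holds (A := A))
      (Complex.ofReal_ne_zero.2 hs) hK (zero_add _)
  · exact lefschetzPow_cup_pull_eq_of_polarizationPairingOne (hros a ac hac) x y
  · -- the field action: `θ_A(a) = ι(a)^*` on `𝓞_K`, then fractions
    refine rosati_of_ringOfIntegers θA (polarizationPairingOne A.X _ (A.dim - 1)) fun a ac hac x y ↦ ?_
    have e1 : θA (a : K) x = complexBetti.map (ιA a).hom.hom.hom 1 x := by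
      rw [← hA.2.2.1 a]
    have e2 : θA (ac : K) y = complexBetti.map (ιA ac).hom.hom.hom 1 y := by
      rw [← hA.2.2.1 ac]
    rw [e1, e2]
    exact hros a ac hac x y

/-- **R2 in Betti form for the chosen realisation of a CM code** `c = (E, Φ)` (`PicardCM.cmRealisation h₃ c`,
record (iii) `CMAbelianVarietyRealised`; it realises `c.Φ` by `Milne1999.cmRealisation_isCMTypeRealisation`). -/
theorem exists_rosatiTheta_cmRealisation (h₃ : CMAbelianVarietyRealised) (c : CMCode) :
    ∃ θ : bettiCohomology (cmRealisation h₃ c).A 2, θ ∈ ratAlgebraicClasses (cmRealisation h₃ c).A 1 ∧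
      lefschetzPowTo θ (cmRealisation h₃ c).AV.dim 0 (2 * (cmRealisation h₃ c).AV.dim) (zero_add _)
        (bettiOne (cmRealisation h₃ c).A) ≠ 0 ∧
      (∀ (a ac : 𝓞 c.E), (ac : c.E) = IsCMField.complexConj c.E (a : c.E) →
        ∀ x y : bettiCohomology (cmRealisation h₃ c).A 1,
          lefschetzPow θ ((cmRealisation h₃ c).AV.dim - 1) 2
              (BettiUniverse.cup (cmRealisation h₃ c).A 1 1
                (BettiUniverse.pull ((cmRealisation h₃ c).ι a).hom.hom.hom 1 x) y) =
            lefschetzPow θ ((cmRealisation h₃ c).AV.dim - 1) 2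
              (BettiUniverse.cup (cmRealisation h₃ c).A 1 1 x
                (BettiUniverse.pull ((cmRealisation h₃ c).ι ac).hom.hom.hom 1 y))) ∧
      ∀ (a : c.E) (x y : complexBetti (cmRealisation h₃ c).A 1),
        polarizationPairingOne (cmRealisation h₃ c).A (ofRatClass (ComplexPoints (cmRealisation h₃ c).A) 2 θ)
            ((cmRealisation h₃ c).AV.dim - 1) ((cmRealisation h₃ c).θ a x) y =
          polarizationPairingOne (cmRealisation h₃ c).A (ofRatClass (ComplexPoints (cmRealisation h₃ c).A) 2 θ)
            ((cmRealisation h₃ c).AV.dim - 1) x ((cmRealisation h₃ c).θ (IsCMField.complexConj c.E a) y) :=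
  exists_rosatiTheta_of_isCMTypeRealisation
    (Literature.AlgebraicGeometry.Milne1999.cmRealisation_isCMTypeRealisation h₃ c)

/-- The dimension of the chosen realisation of a CM code is the model's `Var.dim (.cm c) = [E:ℚ]/2`
(two smoothness-projectivity witnesses of one scheme have the same dimension, `dim_unique`). -/
theorem dim_cmRealisation (h₃ : CMAbelianVarietyRealised) (c : CMCode) :
    (cmRealisation h₃ c).AV.dim = Var.dim (.cm c) :=
  dim_unique (AbelianVariety.isSmoothProjective_holds (A := (cmRealisation h₃ c).AV))
    (cmRealisation h₃ c).isSmoothProjective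

/-- **R2 in Betti form on the Picard–CM model universe**, variety `Var.cm c`: in the model's own spelling
(`Var.Coh hU h₃`, `Var.alg hU h₃`, `Var.dim`) there is `θ ∈ alg (cm c) 1` with `θ^{dim} ≠ 0` in `H^{2 dim}` and
the Rosati identity for the action `(cmRealisation h₃ c).ι` of `𝓞_E`. -/
theorem var_exists_rosatiTheta (hU : BallQuotientUniformisedDatum) (h₃ : CMAbelianVarietyRealised)
    (c : CMCode) :
    ∃ θ : Var.Coh hU h₃ (.cm c) 2, θ ∈ Var.alg hU h₃ (.cm c) 1 ∧
      lefschetzPowTo θ (Var.dim (.cm c)) 0 (2 * Var.dim (.cm c)) (zero_add _)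
        (bettiOne (Var.scheme hU h₃ (.cm c))) ≠ 0 ∧
      ∀ (a ac : 𝓞 c.E), (ac : c.E) = IsCMField.complexConj c.E (a : c.E) →
        ∀ x y : Var.Coh hU h₃ (.cm c) 1,
          lefschetzPow θ (Var.dim (.cm c) - 1) 2
              (BettiUniverse.cup (Var.scheme hU h₃ (.cm c)) 1 1
                (BettiUniverse.pull ((cmRealisation h₃ c).ι a).hom.hom.hom 1 x) y) =
            lefschetzPow θ (Var.dim (.cm c) - 1) 2
              (BettiUniverse.cup (Var.scheme hU h₃ (.cm c)) 1 1 x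
                (BettiUniverse.pull ((cmRealisation h₃ c).ι ac).hom.hom.hom 1 y)) := by
  rw [← dim_cmRealisation h₃ c]
  obtain ⟨θ, h1, h2, h3, -⟩ := exists_rosatiTheta_cmRealisation h₃ c
  exact ⟨θ, h1, h2, h3⟩

end Realisation

/-! ### §3 The identity for the model's rational `K`-action `BettiUniverse.cmAction` and every `a : K` -/

section RationalAction

/-- **R2 for the model universe's `cmAct`.**  For the chosen realisation of a CM code `c` and an abstract
field `K ≃+* c.E` (the package's `K` with `cmCodeEquiv K Φ`), there is `θ ∈ alg (cm c) 1` with `θ^{dim} ≠ 0`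
such that the RATIONAL `K`-action `BettiUniverse.cmAction` on `H¹(A(ℂ); ℚ)` descended from
`θ_c ∘ e : K → End_ℂ H¹(A(ℂ); ℂ)` — the `ι` of the model's `cmAct K Φ = BettiUniverse.cmEndAction …`
(`BettiUniverse.cmEndAction_ι`) — satisfies, for EVERY `a : K` and all `x y ∈ H¹(A(ℂ); ℚ)`,
`θ^{g-1} ⌣ (a·x ⌣ y) = θ^{g-1} ⌣ (x ⌣ ā·y)` (`g = Var.dim (cm c)`).  This is the hypothesis shape `hd` of
`Model.var_deg_diag` (row M19), i.e. what `IsDiagAct` hands to row M22's K-a. -/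
theorem var_exists_rosatiTheta_cmAction (hU : BallQuotientUniformisedDatum) (h₃ : CMAbelianVarietyRealised)
    (c : CMCode) {K : Type} [Field K] [NumberField K] [IsCMField K] (e : K ≃+* c.E) :
    ∃ θ : Var.Coh hU h₃ (.cm c) 2, θ ∈ Var.alg hU h₃ (.cm c) 1 ∧
      lefschetzPowTo θ (Var.dim (.cm c)) 0 (2 * Var.dim (.cm c)) (zero_add _)
        (bettiOne (Var.scheme hU h₃ (.cm c))) ≠ 0 ∧
      ∀ (a : K) (x y : Var.Coh hU h₃ (.cm c) 1),
        lefschetzPow θ (Var.dim (.cm c) - 1) 2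
            (BettiUniverse.cup (Var.scheme hU h₃ (.cm c)) 1 1
              (BettiUniverse.cmAction ((cmRealisation h₃ c).θ.comp e.toRingHom)
                ((cmRealisation h₃ c).exists_map_comp e) a x) y) =
          lefschetzPow θ (Var.dim (.cm c) - 1) 2
            (BettiUniverse.cup (Var.scheme hU h₃ (.cm c)) 1 1 x
              (BettiUniverse.cmAction ((cmRealisation h₃ c).θ.comp e.toRingHom)
                ((cmRealisation h₃ c).exists_map_comp e) (IsCMField.complexConj K a) y)) := by
  rw [← dim_cmRealisation h₃ c]
  obtain ⟨θ, h1, h2, -, h4⟩ := exists_rosatiTheta_cmRealisation h₃ c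
  refine ⟨θ, h1, h2, fun a x y ↦ ?_⟩
  refine lefschetzPow_cup_eq_of_polarizationPairingOne
    (U := fun z ↦ (cmRealisation h₃ c).θ (e a) z)
    (U' := fun z ↦ (cmRealisation h₃ c).θ (e (IsCMField.complexConj K a)) z)
    (fun z ↦ BettiUniverse.ofRatClass_cmAction _ _ a z)
    (fun z ↦ BettiUniverse.ofRatClass_cmAction _ _ (IsCMField.complexConj K a) z) (fun X Y ↦ ?_) x y
  show polarizationPairingOne _ _ _ ((cmRealisation h₃ c).θ (e a) X) Y =
    polarizationPairingOne _ _ _ X ((cmRealisation h₃ c).θ (e (IsCMField.complexConj K a)) Y)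
  rw [ringEquiv_complexConj e a]
  exact h4 (e a) X Y

end RationalAction

end Summit.HodgeConjecture.CorCM.Model

end
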